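import Summits.ValiantsHypothesis.ValiantsHypothesis.Theorems.SymPencilPerFourToricLever

/-!
# Route `SymPencil` — the toric case at dimension `6`, II: two-row spaces with vanishing
# `2 × 2` subpermanents (`--supports` stmt-ValiantsHypothesis-5674 `SdcSuperquadratic`;
# crux workfile `Cruxes/SdcSuperquadratic/TORIC-SIX.md`)

Let `X` be a space of `4 × 4` matrices supported on two rows `p ≠ p'` on which all six `2 × 2`
subpermanents of these rows vanish.

* `finrank_le_two_of_perms_vanish` — if both rows of `X` have rank `≤ 2` then `dim X ≤ 2`
  (`dim X = dim ρ_p X + dim (X ∩ row p')`; a non-zero row `p` makes `X ∩ row p'` at most a line,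
  and a `2`-dimensional row `p` makes it `0`, by perm-orthogonality).
* `rows_eq_pair_of_graph` — if `dim X = 2` and no non-zero element of `X` has row `p` or row `p'`
  zero ("graph type"), then the rows `p, p'` of `X` both fill the same coordinate plane `K^{kl}`
  (`X` is a transposed twisted pair `{(u, P(u_k e_k - u_l e_l))}` there).

Use: the pair spaces `W_R` of a toric `6`-dimensional singular subspace.  Honest framing: linear
algebra for the toric case of `R6`; nothing here changes `sdc(per_4) ≥ 25`; the crux
`SdcSuperquadratic` and `VP ≠ VNP` are untouched.  No definitions, no named facts. [folklore]
-/

noncomputable section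

-- single-conjunct layout: Sub = Summit, duplicated namespace component intended
set_option linter.dupNamespace false

namespace Summit.ValiantsHypothesis.ValiantsHypothesis.Theorems.SymPencilPerFourToricTwoRow

open Matrix Finset Module
open Literature.Computability.AlgebraicComplexity.AlperBogartVelasco
open Summit.ValiantsHypothesis.ValiantsHypothesis.Theorems.SymPencilPerFourToricLever

variable {K : Type*} [Field K]

/-- Polarisation of the vanishing subpermanents against an element with row `p` zero.
[folklore] -/
theorem polar_of_row_zero (X : Submodule K (Fin 4 × Fin 4 → K)) (p p' : Fin 4)
    (hP : ∀ x ∈ X, ∀ l l' : Fin 4, l ≠ l' → x (p, l) * x (p', l') + x (p, l') * x (p', l) = 0)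
    {x z : Fin 4 × Fin 4 → K} (hx : x ∈ X) (hz : z ∈ X) (hzp : ∀ j, z (p, j) = 0) :
    ∀ l l' : Fin 4, l ≠ l' → x (p, l) * z (p', l') + x (p, l') * z (p', l) = 0 := by
  intro l l' hll'
  have h1 := hP (x + z) (X.add_mem hx hz) l l' hll'
  have h0 := hP x hx l l' hll'
  simp only [Pi.add_apply, hzp, add_zero] at h1
  linear_combination h1 - h0

/-- **Two-row spaces with vanishing subpermanents and rows of rank `≤ 2` have dimension `≤ 2`.**
See the module docstring. [folklore] -/
theorem finrank_le_two_of_perms_vanish (X : Submodule K (Fin 4 × Fin 4 → K)) (p p' : Fin 4)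
    (hX : ∀ x ∈ X, ∀ i j : Fin 4, i ≠ p → i ≠ p' → x (i, j) = 0)
    (hP : ∀ x ∈ X, ∀ l l' : Fin 4, l ≠ l' → x (p, l) * x (p', l') + x (p, l') * x (p', l) = 0)
    (hA : finrank K (X.map (LinearMap.funLeft K K fun j : Fin 4 => (p, j))) ≤ 2)
    (hB : finrank K (X.map (LinearMap.funLeft K K fun j : Fin 4 => (p', j))) ≤ 2) :
    finrank K X ≤ 2 := by
  classical
  set ρ : (Fin 4 × Fin 4 → K) →ₗ[K] (Fin 4 → K) := LinearMap.funLeft K K fun j : Fin 4 => (p, j)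
    with hρdef
  set ρ' : (Fin 4 × Fin 4 → K) →ₗ[K] (Fin 4 → K) := LinearMap.funLeft K K fun j : Fin 4 => (p', j)
    with hρ'def
  have hρ : ∀ x j, ρ x j = x (p, j) := fun _ _ => rfl
  have hρ' : ∀ x j, ρ' x j = x (p', j) := fun _ _ => rfl
  -- an element of `X` with rows `p, p'` zero is zero
  have hzero : ∀ x ∈ X, (∀ j, x (p, j) = 0) → (∀ j, x (p', j) = 0) → x = 0 := by
    intro x hx h1 h2
    funext q; obtain ⟨i, j⟩ := q
    by_cases hi : i = p
    · rw [hi]; exact h1 j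
    by_cases hi' : i = p'
    · rw [hi']; exact h2 j
    exact hX x hx i j hi hi'
  set Z : Submodule K (Fin 4 × Fin 4 → K) := X ⊓ LinearMap.ker ρ with hZ
  have memZ : ∀ z, z ∈ Z ↔ z ∈ X ∧ ∀ j, z (p, j) = 0 := fun z => by
    rw [hZ, Submodule.mem_inf, LinearMap.mem_ker]
    exact ⟨fun h => ⟨h.1, fun j => by have := congr_fun h.2 j; rwa [hρ] at this⟩,
      fun h => ⟨h.1, funext fun j => h.2 j⟩⟩
  have hdim := finrank_eq_finrank_map_add_finrank_inf_ker X ρ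
  rw [← hZ] at hdim
  by_cases hA0 : ∀ x ∈ X, ∀ j, x (p, j) = 0
  · -- `X` lives in row `p'`
    have hinj : Function.Injective (ρ'.domRestrict X) := by
      intro x₁ x₂ h
      apply Subtype.ext
      have hsub : ((x₁ : Fin 4 × Fin 4 → K) - x₂) ∈ X := X.sub_mem x₁.2 x₂.2
      refine sub_eq_zero.1 (hzero _ hsub (hA0 _ hsub) fun j => ?_)
      have := congr_fun h j
      simp only [LinearMap.domRestrict_apply, hρ'] at this
      rw [Pi.sub_apply, this, sub_self]
    have h := LinearMap.finrank_range_of_inj hinj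
    rw [LinearMap.range_domRestrict] at h
    rw [← h]; exact hB
  push Not at hA0
  obtain ⟨x₀, hx₀, k, hk⟩ := hA0
  -- `Z` is at most a line: `z ↦ z (p', k)` is injective on `Z`
  have hZ1 : finrank K Z ≤ 1 := by
    have hinj : Function.Injective ((LinearMap.proj (p', k) : (Fin 4 × Fin 4 → K) →ₗ[K] K).domRestrict Z) := by
      intro z₁ z₂ h
      apply Subtype.ext
      have hsub : ((z₁ : Fin 4 × Fin 4 → K) - z₂) ∈ Z := Z.sub_mem z₁.2 z₂.2
      obtain ⟨hsX, hsp⟩ := (memZ _).1 hsub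
      have hk0 : ((z₁ : Fin 4 × Fin 4 → K) - z₂) (p', k) = 0 := by
        have : (LinearMap.proj (p', k) : (Fin 4 × Fin 4 → K) →ₗ[K] K) z₁ =
            (LinearMap.proj (p', k) : (Fin 4 × Fin 4 → K) →ₗ[K] K) z₂ := h
        simp only [LinearMap.proj_apply] at this
        rw [Pi.sub_apply, this, sub_self]
      refine sub_eq_zero.1 (hzero _ hsX hsp fun m => ?_)
      by_cases hmk : m = k
      · rw [hmk]; exact hk0
      have e := polar_of_row_zero X p p' hP hx₀ hsX hsp k m (Ne.symm hmk)
      rw [hk0, mul_zero, add_zero] at e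
      exact (mul_eq_zero.1 e).resolve_left hk
    have h := LinearMap.finrank_le_finrank_of_injective hinj
    rwa [Module.finrank_self] at h
  by_cases hA1 : finrank K (X.map ρ) ≤ 1
  · omega
  -- row `p` has rank `2`: then `Z = 0`
  have hA2 : finrank K (X.map ρ) = 2 := by omega
  have hZ0 : finrank K Z = 0 := by
    rw [Submodule.finrank_eq_zero]
    rw [Submodule.eq_bot_iff]
    intro z hz
    obtain ⟨hzX, hzp⟩ := (memZ z).1 hz
    by_contra hz0
    obtain ⟨k', hk'⟩ : ∃ k', z (p', k') ≠ 0 := by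
      by_contra h
      push Not at h
      exact hz0 (hzero z hzX hzp h)
    -- `v ↦ v k'` is injective on `ρ X`
    have hinj : Function.Injective
        ((LinearMap.proj k' : (Fin 4 → K) →ₗ[K] K).domRestrict (X.map ρ)) := by
      intro v₁ v₂ h
      apply Subtype.ext
      obtain ⟨x₁, hx₁, hv₁⟩ := v₁.2
      obtain ⟨x₂, hx₂, hv₂⟩ := v₂.2
      have hk0 : (v₁ : Fin 4 → K) k' = (v₂ : Fin 4 → K) k' := h
      have hsub : x₁ - x₂ ∈ X := X.sub_mem hx₁ hx₂
      have hdiff : ∀ m, (x₁ - x₂) (p, m) = (v₁ : Fin 4 → K) m - (v₂ : Fin 4 → K) m := fun m => by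
        rw [Pi.sub_apply, ← hρ x₁ m, ← hρ x₂ m, hv₁, hv₂]
      have hk'0 : (x₁ - x₂) (p, k') = 0 := by rw [hdiff, hk0, sub_self]
      funext m
      by_cases hmk : m = k'
      · rw [hmk]; exact hk0
      have e := polar_of_row_zero X p p' hP hsub hzX hzp k' m (Ne.symm hmk)
      rw [hk'0, zero_mul, zero_add] at e
      have := (mul_eq_zero.1 e).resolve_right hk'
      rw [hdiff] at this
      exact sub_eq_zero.1 this
    have h := LinearMap.finrank_le_finrank_of_injective hinj
    rw [Module.finrank_self] at h
    omega
  omega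

/-- **Graph-type pairs are transposed twisted pairs**: both rows of a `2`-dimensional two-row
space with vanishing subpermanents and no single-row elements fill the same coordinate plane
`K^{kl}`.  See the module docstring. [folklore] -/
theorem rows_eq_pair_of_graph [CharZero K] (X : Submodule K (Fin 4 × Fin 4 → K)) (p p' : Fin 4)
    (hP : ∀ x ∈ X, ∀ l l' : Fin 4, l ≠ l' → x (p, l) * x (p', l') + x (p, l') * x (p', l) = 0)
    (hZ : ∀ x ∈ X, (∀ j, x (p, j) = 0) → x = 0) (hZ' : ∀ x ∈ X, (∀ j, x (p', j) = 0) → x = 0)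
    (h2 : finrank K X = 2) :
    ∃ k l : Fin 4, k ≠ l ∧ (∀ x ∈ X, ∀ m, m ≠ k → m ≠ l → x (p, m) = 0 ∧ x (p', m) = 0) ∧
      (∀ v : Fin 4 → K, (∀ m, m ≠ k → m ≠ l → v m = 0) → ∃ x ∈ X, ∀ j, x (p, j) = v j) ∧
      (∀ v : Fin 4 → K, (∀ m, m ≠ k → m ≠ l → v m = 0) → ∃ x ∈ X, ∀ j, x (p', j) = v j) := by
  classical
  -- polarisation between two elements
  have polar : ∀ x ∈ X, ∀ y ∈ X, ∀ l l' : Fin 4, l ≠ l' →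
      x (p, l) * y (p', l') + x (p, l') * y (p', l) + (y (p, l) * x (p', l') + y (p, l') * x (p', l))
        = 0 := by
    intro x hx y hy l l' hll'
    have h1 := hP (x + y) (X.add_mem hx hy) l l' hll'
    have hx0 := hP x hx l l' hll'
    have hy0 := hP y hy l l' hll'
    simp only [Pi.add_apply] at h1
    linear_combination h1 - hx0 - hy0
  -- a non-zero element `x`, its support pair
  have hpos : 0 < finrank K X := by rw [h2]; norm_num
  obtain ⟨⟨x, hx⟩, hx0⟩ := (Module.finrank_pos_iff_exists_ne_zero (R := K) (M := ↥X)).1 hpos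
  have hx0' : x ≠ 0 := fun h => hx0 (Subtype.ext h)
  have hu : (fun j => x (p, j)) ≠ 0 := fun h => hx0' (hZ x hx fun j => congr_fun h j)
  have hw : (fun j => x (p', j)) ≠ 0 := fun h => hx0' (hZ' x hx fun j => congr_fun h j)
  obtain ⟨k, l, hkl, huk, hwk, hsupp, hukl⟩ :=
    support_pair_of_perm_orth (fun j => x (p, j)) (fun j => x (p', j)) hu hw (hP x hx)
  -- a second element `y ≠ 0` with `y (p, k) = 0`
  obtain ⟨y, hyX, hy0, hyk⟩ : ∃ y ∈ X, y ≠ 0 ∧ y (p, k) = 0 := by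
    have hlt : finrank K K < finrank K X := by rw [Module.finrank_self, h2]; norm_num
    have hne := LinearMap.ker_ne_bot_of_finrank_lt
      (f := (LinearMap.proj (p, k) : (Fin 4 × Fin 4 → K) →ₗ[K] K).domRestrict X) hlt
    obtain ⟨⟨y, hyX⟩, hyker, hy0⟩ := Submodule.exists_mem_ne_zero_of_ne_bot hne
    refine ⟨y, hyX, fun h => hy0 (Subtype.ext h), ?_⟩
    simpa [LinearMap.mem_ker] using hyker
  have hu' : (fun j => y (p, j)) ≠ 0 := fun h => hy0 (hZ y hyX fun j => congr_fun h j)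
  have hw' : (fun j => y (p', j)) ≠ 0 := fun h => hy0 (hZ' y hyX fun j => congr_fun h j)
  -- `x` and `y` span `X`
  have hspan : ∀ z ∈ X, ∃ α β : K, z = α • x + β • y := by
    have hli : LinearIndependent K ![x, y] := by
      rw [LinearIndependent.pair_iff]
      intro s t hst
      have hk' := congr_fun hst (p, k)
      simp only [Pi.add_apply, Pi.smul_apply, smul_eq_mul, hyk, mul_zero, add_zero,
        Pi.zero_apply] at hk'
      have hs : s = 0 := (mul_eq_zero.1 hk').resolve_right huk
      rw [hs, zero_smul, zero_add] at hst
      exact ⟨hs, (smul_eq_zero.1 hst).resolve_right hy0⟩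
    have hle : Submodule.span K (Set.range ![x, y]) ≤ X := by
      rw [Submodule.span_le]
      rintro _ ⟨i, rfl⟩
      fin_cases i
      · exact hx
      · exact hyX
    have heq : Submodule.span K (Set.range ![x, y]) = X :=
      Submodule.eq_of_le_of_finrank_le hle (by rw [h2, finrank_span_eq_card hli, Fintype.card_fin])
    intro z hz
    rw [← heq, Submodule.mem_span_range_iff_exists_fun] at hz
    obtain ⟨c, hc⟩ := hz
    exact ⟨c 0, c 1, by rw [← hc, Fin.sum_univ_two]; rfl⟩
  -- entries of `y` outside `{k, l}`: (*) `x_{pk} y_{p'm} + y_{pm} x_{p'k} = 0`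
  have star : ∀ m, m ≠ k → m ≠ l → x (p, k) * y (p', m) + y (p, m) * x (p', k) = 0 := by
    intro m hmk hml
    have e := polar x hx y hyX k m (Ne.symm hmk)
    rw [(hsupp m hmk hml).1, hyk] at e
    linear_combination e
  by_cases hul : x (p, l) = 0
  · ---- `u = u_k e_k`: the second index comes from `y`
    have hwl : x (p', l) = 0 := by
      have e := hukl
      simp only [hul, zero_mul, add_zero] at e
      exact (mul_eq_zero.1 e).resolve_left huk
    have hxm : ∀ m, m ≠ k → x (p, m) = 0 ∧ x (p', m) = 0 := by
      intro m hmk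
      by_cases hml : m = l
      · rw [hml]; exact ⟨hul, hwl⟩
      · exact hsupp m hmk hml
    have star' : ∀ m, m ≠ k → x (p, k) * y (p', m) + y (p, m) * x (p', k) = 0 := by
      intro m hmk
      have e := polar x hx y hyX k m (Ne.symm hmk)
      simp only [(hxm m hmk).1, (hxm m hmk).2, hyk, zero_mul, mul_zero, add_zero, zero_add] at e
      linear_combination e
    obtain ⟨k', hk'⟩ : ∃ k', y (p, k') ≠ 0 := by
      by_contra h; push Not at h; exact hu' (funext h)
    have hk'k : k' ≠ k := fun h => hk' (by rw [h, hyk])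
    have hywk : y (p', k) = 0 := by
      have e := hP y hyX k k' hk'k.symm
      simp only [hyk, zero_mul, zero_add] at e
      exact (mul_eq_zero.1 e).resolve_left hk'
    have hprod : ∀ m m', m ≠ k → m' ≠ k → m ≠ m' → y (p, m) * y (p, m') = 0 := by
      intro m m' hm hm' hmm'
      have e := hP y hyX m m' hmm'
      have e1 := star' m hm
      have e2 := star' m' hm'
      have h2 : (2 : K) * x (p', k) * (y (p, m) * y (p, m')) = 0 := by
        linear_combination (-(x (p, k))) * e + y (p, m) * e2 + y (p, m') * e1
      rcases mul_eq_zero.1 h2 with h2 | h2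
      · exact absurd h2 (mul_ne_zero two_ne_zero hwk)
      · exact h2
    have hym : ∀ m, m ≠ k → m ≠ k' → y (p, m) = 0 ∧ y (p', m) = 0 := by
      intro m hmk hmk'
      have h1 : y (p, m) = 0 := by
        have := hprod k' m hk'k hmk (Ne.symm hmk')
        exact (mul_eq_zero.1 this).resolve_left hk'
      refine ⟨h1, ?_⟩
      have e := star' m hmk
      simp only [h1, zero_mul, add_zero] at e
      exact (mul_eq_zero.1 e).resolve_left huk
    have hyw' : y (p', k') ≠ 0 := by
      intro h
      apply hw'
      funext m
      by_cases hmk : m = k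
      · rw [hmk]; exact hywk
      by_cases hmk' : m = k'
      · rw [hmk']; exact h
      · exact (hym m hmk hmk').2
    refine ⟨k, k', hk'k.symm, fun z hz m hmk hmk' => ?_, fun v hv => ?_, fun v hv => ?_⟩
    · obtain ⟨α, β, rfl⟩ := hspan z hz
      simp only [Pi.add_apply, Pi.smul_apply, smul_eq_mul, (hxm m hmk).1, (hxm m hmk).2,
        (hym m hmk hmk').1, (hym m hmk hmk').2, mul_zero, add_zero, and_self]
    · refine ⟨(v k / x (p, k)) • x + (v k' / y (p, k')) • y,
        X.add_mem (X.smul_mem _ hx) (X.smul_mem _ hyX), fun j => ?_⟩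
      simp only [Pi.add_apply, Pi.smul_apply, smul_eq_mul]
      by_cases hjk : j = k
      · rw [hjk, hyk, mul_zero, add_zero, div_mul_cancel₀ _ huk]
      by_cases hjk' : j = k'
      · rw [hjk', (hxm k' hk'k).1, mul_zero, zero_add, div_mul_cancel₀ _ hk']
      rw [(hxm j hjk).1, (hym j hjk hjk').1, hv j hjk hjk', mul_zero, mul_zero, add_zero]
    · refine ⟨(v k / x (p', k)) • x + (v k' / y (p', k')) • y,
        X.add_mem (X.smul_mem _ hx) (X.smul_mem _ hyX), fun j => ?_⟩
      simp only [Pi.add_apply, Pi.smul_apply, smul_eq_mul]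
      by_cases hjk : j = k
      · rw [hjk, hywk, mul_zero, add_zero, div_mul_cancel₀ _ hwk]
      by_cases hjk' : j = k'
      · rw [hjk', (hxm k' hk'k).2, mul_zero, zero_add, div_mul_cancel₀ _ hyw']
      rw [(hxm j hjk).2, (hym j hjk hjk').2, hv j hjk hjk', mul_zero, mul_zero, add_zero]
  · ---- `u_l ≠ 0`: `y` is supported on `{l}`
    have hym1 : ∀ m, m ≠ k → m ≠ l → y (p, m) = 0 := by
      intro m hmk hml
      have e1 := star m hmk hml
      have e2 := polar x hx y hyX l m (Ne.symm hml)
      simp only [(hsupp m hmk hml).1, (hsupp m hmk hml).2, zero_mul, mul_zero, add_zero,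
        zero_add] at e2
      -- e2 : x_{pl} y_{p'm} + y_{pm} x_{p'l} = 0 ; e1 : x_{pk} y_{p'm} + y_{pm} x_{p'k} = 0
      have h2 : (2 : K) * (x (p, l) * x (p', k)) * y (p, m) = 0 := by
        linear_combination x (p, l) * e1 - x (p, k) * e2 + y (p, m) * hukl
      rcases mul_eq_zero.1 h2 with h2 | h2
      · exact absurd h2 (mul_ne_zero two_ne_zero (mul_ne_zero hul hwk))
      · exact h2
    have hyl : y (p, l) ≠ 0 := by
      intro h
      apply hu'
      funext m
      by_cases hmk : m = k
      · rw [hmk]; exact hyk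
      by_cases hml : m = l
      · rw [hml]; exact h
      · exact hym1 m hmk hml
    have hywk : y (p', k) = 0 := by
      have e := hP y hyX l k hkl.symm
      simp only [hyk, zero_mul, add_zero] at e
      exact (mul_eq_zero.1 e).resolve_left hyl
    have hywm : ∀ m, m ≠ k → m ≠ l → y (p', m) = 0 := by
      intro m hmk hml
      have e := star m hmk hml
      simp only [hym1 m hmk hml, zero_mul, add_zero] at e
      exact (mul_eq_zero.1 e).resolve_left huk
    have hywl : y (p', l) ≠ 0 := by
      intro h
      apply hw'
      funext m
      by_cases hmk : m = k
      · rw [hmk]; exact hywk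
      by_cases hml : m = l
      · rw [hml]; exact h
      · exact hywm m hmk hml
    refine ⟨k, l, hkl, fun z hz m hmk hml => ?_, fun v hv => ?_, fun v hv => ?_⟩
    · obtain ⟨α, β, rfl⟩ := hspan z hz
      simp only [Pi.add_apply, Pi.smul_apply, smul_eq_mul, (hsupp m hmk hml).1,
        (hsupp m hmk hml).2, hym1 m hmk hml, hywm m hmk hml, mul_zero, add_zero, and_self]
    · refine ⟨(v k / x (p, k)) • x + ((v l - v k / x (p, k) * x (p, l)) / y (p, l)) • y,
        X.add_mem (X.smul_mem _ hx) (X.smul_mem _ hyX), fun j => ?_⟩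
      simp only [Pi.add_apply, Pi.smul_apply, smul_eq_mul]
      by_cases hjk : j = k
      · rw [hjk, hyk, mul_zero, add_zero, div_mul_cancel₀ _ huk]
      by_cases hjl : j = l
      · rw [hjl, div_mul_cancel₀ _ hyl]; ring
      rw [(hsupp j hjk hjl).1, hym1 j hjk hjl, hv j hjk hjl, mul_zero, mul_zero, add_zero]
    · refine ⟨(v k / x (p', k)) • x + ((v l - v k / x (p', k) * x (p', l)) / y (p', l)) • y,
        X.add_mem (X.smul_mem _ hx) (X.smul_mem _ hyX), fun j => ?_⟩
      simp only [Pi.add_apply, Pi.smul_apply, smul_eq_mul]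
      by_cases hjk : j = k
      · rw [hjk, hywk, mul_zero, add_zero, div_mul_cancel₀ _ hwk]
      by_cases hjl : j = l
      · rw [hjl, div_mul_cancel₀ _ hywl]; ring
      rw [(hsupp j hjk hjl).2, hywm j hjk hjl, hv j hjk hjl, mul_zero, mul_zero, add_zero]

end Summit.ValiantsHypothesis.ValiantsHypothesis.Theorems.SymPencilPerFourToricTwoRow

end
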